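import Literature.MathematicalPhysics.QuantumLattice.DWaveSourceEnergyDensityExists
import Literature.MathematicalPhysics.QuantumLattice.DWaveSourceEnergyDensityLimit
import HarnessLib

/-!
# Transport in the pinning field `h` for the sourced ground-state energy density `e_src(U, μ, h)`, and
# the Griffiths / cusp dictionary of the `d`-wave order parameter made UNCONDITIONAL

Topic `Literature/MathematicalPhysics/QuantumLattice` (family `hubbard`); sequel of
`DWaveSourceEnergyDensityExists.lean` (`e_src(U,μ,h) = dWaveSourceEnergyDensity U μ h = lim_L E₀(A_L)/L²`
EXISTS, `tendsto_dWaveSourceEnergyDensity`) and of `DWaveSourceEnergyDensityLimit.lean` (the Griffiths /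
cusp dictionary for the Koma–Tasaki order parameter `dWaveOrderParameter U μ`, CONDITIONAL on a limit
`g` of `E_{L+1}(h)/(L+1)²`). Here the hypothesis `hg` of the latter is discharged by the former:
`g := dWaveSourceEnergyDensity U μ`. Written for the pinning-field programme of the Hubbard cuprate cell
(`hubbard-cq`, LADDER rows PC-a "pinning-field response" / PC-c "non-analyticity of `e₀(h)`" / R1b
"transport theorems verbatim in `h`").

* §1 finite volume: `groundEnergy_dWaveSourceTorus_anti` (`0 ≤ h ≤ h' ⇒ E_L(h') ≤ E_L(h)`).
* §2 thermodynamic limit, UNCONDITIONAL: `e_src(U,μ,·)` is concave on `ℝ`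
  (`concaveOn_dWaveSourceEnergyDensity`), non-increasing on `[0,∞)` (`dWaveSourceEnergyDensity_anti`),
  below its source-free value (`dWaveSourceEnergyDensity_le_at_zero`) and `2B_d`-Lipschitz
  (`abs_dWaveSourceEnergyDensity_sub_le`, `B_d = 2Σ_e|d(e)/√2|`); GRIFFITHS' LEMMA: at a differentiability
  point `h` of `e_src`, `m_{L+1}(h) → −e_src′(h)/2` (`tendsto_dWaveSourceDensity_of_hasDerivAt_energyDensity`),
  with the one-sided `liminf`/`limsup` halves; THE CUSP IDENTITY
  `dWaveOrderParameter U μ = ⨅_{h>0} (e_src(0) − e_src(h))/(2h) = lim_{h→0⁺} (e_src(0) − e_src(h))/(2h)`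
  (`dWaveOrderParameter_eq_iInf_slope_energyDensity`, `tendsto_slope_energyDensity_dWaveOrderParameter`),
  `= −e_src′₊(0)/2` when the right derivative exists; `HasDWaveOrder U μ ↔` a linear cusp of `e_src` at
  `0`; and the ONE-CHORD CEILING `dWaveOrderParameter U μ ≤ (hi₀ − lo_h)/(2h)` from a certified upper
  bound `e_src(0) ≤ hi₀` and a certified lower bound `lo_h ≤ e_src(h)` at one `h > 0`
  (`dWaveOrderParameter_le_of_windows` — the CQ-TABLE "m⋆ ceiling" row in thermodynamic-limit form).
* §3 TRANSPORT OF CERTIFIED WINDOWS on `e_src` (the rules a region engine consumes; no certificate is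
  solved): barycentric and chord LOWER bounds, outward UPPER bound
  `e_src(h₂ + θ(h₂ − h₁)) ≤ hi₂ + θ(hi₂ − lo₁)`, monotone transport on `h ≥ 0`, Lipschitz transport.

Everything is PROVED; no definition, no named fact. HONEST SCOPE: `t' = 0`, hopping `1`; a finite-`h`
window or chord gives a CEILING on `dWaveOrderParameter`, never a floor (`le_dWaveOrderParameter_iff_forall`);
nothing here bears on whether the Hubbard model has `d`-wave order.

## References
* T. Koma, H. Tasaki, J. Stat. Phys. 76 (1994) 745, §1 (ground-state energy concave in the source;
  order parameter as `h → 0⁺` after the volume limit). [cite: KomaTasaki1994, §1]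
* R. B. Griffiths, Phys. Rev. 152 (1966) 240, §II (one-sided derivatives of the limiting energy bound
  the conjugate one-point function). [cite: Griffiths1966, §II]
* R. B. Griffiths, J. Math. Phys. 5 (1964) 1215, §II (concavity / secant bounds). [cite: Griffiths1964, §II]
* R. B. Israel, *Convexity in the Theory of Lattice Gases* (1979), Thm. I.3.4 (Lipschitz continuity in the
  interaction norm). [cite: Israel1979, Thm. I.3.4]
-/

noncomputable section

namespace Literature.MathematicalPhysics.QuantumLattice

open _root_.Matrix Finset HubbardWave0 Literature.Probability.LatticeModels _root_.Filter
open scoped _root_.Topology ComplexOrder BigOperators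

/-! ### §1 Finite volume -/

/-- **Monotonicity on `h ≥ 0`, finite volume**: `0 ≤ h ≤ h' ⇒ E₀(A_L(h')) ≤ E₀(A_L(h))` (the sourced pair
density is `≥ 0` for `h ≥ 0`). [cite: KomaTasaki1994, §1] -/
theorem groundEnergy_dWaveSourceTorus_anti (L : ℕ) [NeZero L] (U μ : ℝ) {h h' : ℝ} (hh : 0 ≤ h)
    (hle : h ≤ h') :
    (dWaveSourceTorus L U μ h').groundEnergy ≤ (dWaveSourceTorus L U μ h).groundEnergy := by
  have h1 := dWaveSourceDensity_mul_le_groundEnergy_drop (L := L) U μ h h'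
  have h2 : 0 ≤ dWaveSourceDensity L U μ h := dWaveSourceDensity_nonneg U μ hh
  have hL : (0 : ℝ) ≤ 2 * (L : ℝ) ^ 2 * dWaveSourceDensity L U μ h := by positivity
  nlinarith [h1, hL, sub_nonneg.2 hle]

/-! ### §2 Thermodynamic limit: the conditional dictionary made unconditional -/

section Limit

variable (U μ : ℝ)

/-- **`h ↦ e_src(U,μ,h)` is concave on `ℝ`** (pointwise limit of the concave `E₀(A_{L+1})/(L+1)²`).
[cite: Griffiths1964, §II] -/
theorem concaveOn_dWaveSourceEnergyDensity :
    ConcaveOn ℝ Set.univ fun h : ℝ => dWaveSourceEnergyDensity U μ h := by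
  refine ⟨convex_univ, fun x _ y _ p q hp hq hpq => ?_⟩
  simp only [smul_eq_mul]
  have hlim := ((tendsto_dWaveSourceEnergyDensity U μ x).const_mul p).add
    ((tendsto_dWaveSourceEnergyDensity U μ y).const_mul q)
  refine le_of_tendsto_of_tendsto' hlim (tendsto_dWaveSourceEnergyDensity U μ (p * x + q * y)) fun L => ?_
  have hc := (concaveOn_groundEnergy_dWaveSourceTorus U μ (L + 1)).2 (Set.mem_univ x) (Set.mem_univ y)
    hp hq hpq
  simp only [smul_eq_mul] at hc
  have hpos : (0 : ℝ) < (((L + 1 : ℕ) : ℝ)) ^ 2 := by positivity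
  rw [← mul_div_assoc, ← mul_div_assoc, ← add_div]
  exact div_le_div_of_nonneg_right hc hpos.le

/-- The `[0,∞)` form, through the conditional lemma of the cusp file. [cite: KomaTasaki1994, §1] -/
theorem concaveOn_Ici_dWaveSourceEnergyDensity :
    ConcaveOn ℝ (Set.Ici 0) (dWaveSourceEnergyDensity U μ) :=
  concaveOn_Ici_of_tendsto_groundEnergy_dWaveSource U μ fun h _ => tendsto_dWaveSourceEnergyDensity U μ h

/-- **Monotonicity on `h ≥ 0`**: `0 ≤ h ≤ h' ⇒ e_src(h') ≤ e_src(h)`. [cite: KomaTasaki1994, §1] -/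
theorem dWaveSourceEnergyDensity_anti {h h' : ℝ} (hh : 0 ≤ h) (hle : h ≤ h') :
    dWaveSourceEnergyDensity U μ h' ≤ dWaveSourceEnergyDensity U μ h := by
  refine le_of_tendsto_of_tendsto' (tendsto_dWaveSourceEnergyDensity U μ h')
    (tendsto_dWaveSourceEnergyDensity U μ h) fun L => ?_
  have hpos : (0 : ℝ) < (((L + 1 : ℕ) : ℝ)) ^ 2 := by positivity
  exact div_le_div_of_nonneg_right (groundEnergy_dWaveSourceTorus_anti (L + 1) U μ hh hle) hpos.le

/-- **The source never raises the energy density**: `e_src(U,μ,h) ≤ e_src(U,μ,0)` for every real `h`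
(`groundEnergy_dWaveSourceTorus_le`). [cite: KomaTasaki1994, §1] -/
theorem dWaveSourceEnergyDensity_le_at_zero (h : ℝ) :
    dWaveSourceEnergyDensity U μ h ≤ dWaveSourceEnergyDensity U μ 0 := by
  refine le_of_tendsto_of_tendsto' (tendsto_dWaveSourceEnergyDensity U μ h)
    (tendsto_dWaveSourceEnergyDensity U μ 0) fun L => ?_
  have hpos : (0 : ℝ) < (((L + 1 : ℕ) : ℝ)) ^ 2 := by positivity
  exact div_le_div_of_nonneg_right (groundEnergy_dWaveSourceTorus_le (L := L + 1) U μ h) hpos.le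

/-- **Lipschitz continuity in the source**: `|e_src(h) − e_src(h')| ≤ 2 B_d |h − h'|`,
`B_d = 2Σ_e |d(e)/√2|`. [cite: Israel1979, Thm. I.3.4] -/
theorem abs_dWaveSourceEnergyDensity_sub_le (h h' : ℝ) :
    |dWaveSourceEnergyDensity U μ h - dWaveSourceEnergyDensity U μ h'| ≤
      2 * (2 * ∑ e ∈ insert (0 : Site 2) unitSteps, |dWaveFormFactor e / Real.sqrt 2|) * |h - h'| :=
  abs_sub_le_of_tendsto_groundEnergy_dWaveSource U μ (g := dWaveSourceEnergyDensity U μ)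
    (tendsto_dWaveSourceEnergyDensity U μ h) (tendsto_dWaveSourceEnergyDensity U μ h')

/-- **Griffiths' lemma in the source, unconditional**: at a differentiability point `h` of
`e_src(U,μ,·)` with derivative `e'`, the sourced pair densities converge, `m_{L+1}(h) → −e'/2`.
[cite: Griffiths1966, §II] -/
theorem tendsto_dWaveSourceDensity_of_hasDerivAt_energyDensity {h e' : ℝ}
    (hd : HasDerivAt (dWaveSourceEnergyDensity U μ) e' h) :
    Tendsto (fun L : ℕ => dWaveSourceDensity (L + 1) U μ h) atTop (𝓝 (-e' / 2)) :=
  tendsto_dWaveSourceDensity_of_hasDerivAt U μ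
    (Eventually.of_forall fun h' => tendsto_dWaveSourceEnergyDensity U μ h') hd

/-- **Left half**: a left derivative `e'₋` of `e_src` at `h` gives `−e'₋/2 ≤ liminf_L m_{L+1}(h)`.
[cite: Griffiths1966, §II] -/
theorem neg_half_leftDeriv_le_liminf_dWaveSourceDensity {h e' : ℝ}
    (hd : HasDerivWithinAt (dWaveSourceEnergyDensity U μ) e' (Set.Iio h) h) :
    -e' / 2 ≤ liminf (fun L : ℕ => dWaveSourceDensity (L + 1) U μ h) atTop :=
  neg_half_deriv_le_liminf_dWaveSourceDensity U μ
    (Eventually.of_forall fun h₁ => tendsto_dWaveSourceEnergyDensity U μ h₁)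
    (tendsto_dWaveSourceEnergyDensity U μ h) hd

/-- **Right half**: a right derivative `e'₊` of `e_src` at `h` gives `limsup_L m_{L+1}(h) ≤ −e'₊/2`.
[cite: Griffiths1966, §II] -/
theorem limsup_dWaveSourceDensity_le_neg_half_rightDeriv {h e' : ℝ}
    (hd : HasDerivWithinAt (dWaveSourceEnergyDensity U μ) e' (Set.Ioi h) h) :
    limsup (fun L : ℕ => dWaveSourceDensity (L + 1) U μ h) atTop ≤ -e' / 2 :=
  limsup_dWaveSourceDensity_le_neg_half_deriv U μ
    (Eventually.of_forall fun h₂ => tendsto_dWaveSourceEnergyDensity U μ h₂)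
    (tendsto_dWaveSourceEnergyDensity U μ h) hd

/-- **THE CUSP IDENTITY, infimum form (unconditional)**:
`dWaveOrderParameter U μ = ⨅_{h>0} (e_src(0) − e_src(h))/(2h)`. [cite: KomaTasaki1994, §1] -/
theorem dWaveOrderParameter_eq_iInf_slope_energyDensity :
    dWaveOrderParameter U μ =
      ⨅ h : Set.Ioi (0 : ℝ), (dWaveSourceEnergyDensity U μ 0 - dWaveSourceEnergyDensity U μ h) / (2 * h) :=
  dWaveOrderParameter_eq_iInf_slope U μ fun h _ => tendsto_dWaveSourceEnergyDensity U μ h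

/-- **THE CUSP IDENTITY, limit form (unconditional)**:
`(e_src(0) − e_src(h))/(2h) → dWaveOrderParameter U μ` as `h → 0⁺`. [cite: KomaTasaki1994, §1] -/
theorem tendsto_slope_energyDensity_dWaveOrderParameter :
    Tendsto (fun h : ℝ => (dWaveSourceEnergyDensity U μ 0 - dWaveSourceEnergyDensity U μ h) / (2 * h))
      (𝓝[>] 0) (𝓝 (dWaveOrderParameter U μ)) :=
  tendsto_slope_nhdsGT_dWaveOrderParameter U μ fun h _ => tendsto_dWaveSourceEnergyDensity U μ h

/-- **THE CUSP IDENTITY, derivative form (unconditional)**: if `e_src(U,μ,·)` has a right derivative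
`e'₊(0)` at `h = 0`, then `dWaveOrderParameter U μ = −e'₊(0)/2`. [cite: Griffiths1966, §II] -/
theorem dWaveOrderParameter_eq_neg_half_rightDeriv_energyDensity {e' : ℝ}
    (hd : HasDerivWithinAt (dWaveSourceEnergyDensity U μ) e' (Set.Ioi 0) 0) :
    dWaveOrderParameter U μ = -e' / 2 :=
  dWaveOrderParameter_eq_neg_half_deriv U μ (fun h _ => tendsto_dWaveSourceEnergyDensity U μ h) hd

/-- **`d`-wave order IS a linear cusp of `e_src` at `h = 0` (unconditional)**:
`HasDWaveOrder U μ ↔ ∃ c > 0, ∀ h > 0, e_src(h) ≤ e_src(0) − 2ch`. [cite: KomaTasaki1994, §1] -/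
theorem hasDWaveOrder_iff_linear_cusp_energyDensity :
    HasDWaveOrder U μ ↔ ∃ c : ℝ, 0 < c ∧ ∀ h : ℝ, 0 < h →
      dWaveSourceEnergyDensity U μ h ≤ dWaveSourceEnergyDensity U μ 0 - 2 * c * h :=
  hasDWaveOrder_iff_linear_cusp U μ fun h _ => tendsto_dWaveSourceEnergyDensity U μ h

/-- **No kink, no order (unconditional)**: a vanishing right derivative of `e_src` at `0` excludes
`d`-wave order. [cite: KomaTasaki1994, §1] -/
theorem not_hasDWaveOrder_of_rightDeriv_energyDensity_zero
    (hd : HasDerivWithinAt (dWaveSourceEnergyDensity U μ) 0 (Set.Ioi 0) 0) : ¬ HasDWaveOrder U μ :=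
  not_hasDWaveOrder_of_hasDerivWithinAt_zero U μ (fun h _ => tendsto_dWaveSourceEnergyDensity U μ h) hd

/-- **The sign of the kink decides (unconditional)**: with a right derivative `e'₊(0)` of `e_src` at `0`,
`HasDWaveOrder U μ ↔ e'₊(0) < 0`. [cite: KomaTasaki1994, §1] -/
theorem hasDWaveOrder_iff_rightDeriv_energyDensity_neg {e' : ℝ}
    (hd : HasDerivWithinAt (dWaveSourceEnergyDensity U μ) e' (Set.Ioi 0) 0) :
    HasDWaveOrder U μ ↔ e' < 0 :=
  hasDWaveOrder_iff_deriv_neg U μ (fun h _ => tendsto_dWaveSourceEnergyDensity U μ h) hd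

/-- **One chord bounds the order parameter from above**: for every `h > 0`,
`dWaveOrderParameter U μ ≤ (e_src(0) − e_src(h))/(2h)`. [cite: KomaTasaki1994, §1] -/
theorem dWaveOrderParameter_le_slope_energyDensity {h : ℝ} (hh : 0 < h) :
    dWaveOrderParameter U μ ≤
      (dWaveSourceEnergyDensity U μ 0 - dWaveSourceEnergyDensity U μ h) / (2 * h) := by
  set e : ℝ → ℝ := dWaveSourceEnergyDensity U μ with he
  have hbdd : BddBelow (Set.range fun h' : Set.Ioi (0 : ℝ) => (e 0 - e h') / (2 * (h' : ℝ))) := by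
    refine ⟨0, ?_⟩
    rintro x ⟨h', rfl⟩
    have h0 : (0 : ℝ) < (h' : ℝ) := h'.2
    have h1 : e h' ≤ e 0 := dWaveSourceEnergyDensity_le_at_zero U μ h'
    exact div_nonneg (sub_nonneg.2 h1) (by positivity)
  have key := ciInf_le hbdd ⟨h, hh⟩
  rw [dWaveOrderParameter_eq_iInf_slope_energyDensity]
  exact key

/-- **The "m⋆ ceiling" row in thermodynamic-limit form**: a certified LOWER bound `lo ≤ e_src(h)` at ONE
source strength `h > 0` and a certified UPPER bound `e_src(0) ≤ hi` on the source-free energy density give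
`dWaveOrderParameter U μ ≤ (hi − lo)/(2h)`. (A ceiling, never a floor: `le_dWaveOrderParameter_iff_forall`.)
[cite: KomaTasaki1994, §1] -/
theorem dWaveOrderParameter_le_of_windows {h lo hi : ℝ} (hh : 0 < h)
    (hlo : lo ≤ dWaveSourceEnergyDensity U μ h) (hhi : dWaveSourceEnergyDensity U μ 0 ≤ hi) :
    dWaveOrderParameter U μ ≤ (hi - lo) / (2 * h) := by
  refine (dWaveOrderParameter_le_slope_energyDensity U μ hh).trans ?_
  exact div_le_div_of_nonneg_right (by linarith) (by positivity)

end Limit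

/-! ### §3 Transport of certified windows -/

section Transport

variable (U μ : ℝ)

/-- **Barycentric LOWER bound** (Jensen): certified `lo₁ ≤ e_src(h₁)`, `lo₂ ≤ e_src(h₂)` and convex
weights `p, q ≥ 0`, `p + q = 1` give `p·lo₁ + q·lo₂ ≤ e_src(p h₁ + q h₂)` — every point between two
certified lower bounds is certified from below. [cite: Griffiths1964, §II] -/
theorem dWaveSourceEnergyDensity_convexComb_ge {h₁ h₂ lo₁ lo₂ p q : ℝ} (hp : 0 ≤ p) (hq : 0 ≤ q)
    (hpq : p + q = 1) (h1 : lo₁ ≤ dWaveSourceEnergyDensity U μ h₁) (h2 : lo₂ ≤ dWaveSourceEnergyDensity U μ h₂) :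
    p * lo₁ + q * lo₂ ≤ dWaveSourceEnergyDensity U μ (p * h₁ + q * h₂) := by
  have hc := (concaveOn_dWaveSourceEnergyDensity U μ).2 (Set.mem_univ h₁) (Set.mem_univ h₂) hp hq hpq
  simp only [smul_eq_mul] at hc
  nlinarith [hc, mul_le_mul_of_nonneg_left h1 hp, mul_le_mul_of_nonneg_left h2 hq]

/-- **Chord LOWER bound between two anchors** (the barycentric bound in coordinates): for `h₁ < h₂` and
`h ∈ [h₁, h₂]`, `lo₁ + (lo₂ − lo₁)(h − h₁)/(h₂ − h₁) ≤ e_src(h)`. [cite: Griffiths1964, §II] -/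
theorem dWaveSourceEnergyDensity_ge_chord {h₁ h₂ h lo₁ lo₂ : ℝ} (hlt : h₁ < h₂) (ha : h₁ ≤ h) (hb : h ≤ h₂)
    (h1 : lo₁ ≤ dWaveSourceEnergyDensity U μ h₁) (h2 : lo₂ ≤ dWaveSourceEnergyDensity U μ h₂) :
    lo₁ + (lo₂ - lo₁) * (h - h₁) / (h₂ - h₁) ≤ dWaveSourceEnergyDensity U μ h := by
  have hd : 0 < h₂ - h₁ := sub_pos.2 hlt
  set q : ℝ := (h - h₁) / (h₂ - h₁) with hqdef
  set p : ℝ := 1 - q with hpdef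
  have hq0 : 0 ≤ q := div_nonneg (sub_nonneg.2 ha) hd.le
  have hq1 : q ≤ 1 := by rw [hqdef, div_le_one hd]; linarith
  have hp0 : 0 ≤ p := by rw [hpdef]; linarith
  have hpq : p + q = 1 := by rw [hpdef]; ring
  have key := dWaveSourceEnergyDensity_convexComb_ge U μ hp0 hq0 hpq h1 h2
  have hh : p * h₁ + q * h₂ = h := by
    rw [hpdef, hqdef]; field_simp; ring
  rw [hh] at key
  have hval : p * lo₁ + q * lo₂ = lo₁ + (lo₂ - lo₁) * (h - h₁) / (h₂ - h₁) := by
    rw [hpdef, hqdef]; field_simp; ring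
  linarith [key, hval]

/-- **Outward UPPER bound along the source axis**: for `h₁ < h₂`, a certified lower bound `lo₁ ≤ e_src(h₁)`
and a certified upper bound `e_src(h₂) ≤ hi₂` give, at `h₃ = h₂ + θ(h₂ − h₁)` (`θ ≥ 0`, beyond `h₂`),
`e_src(h₃) ≤ hi₂ + θ(hi₂ − lo₁)` (concavity: `h₂` is a convex combination of `h₁` and `h₃`).
[cite: Griffiths1964, §II] -/
theorem dWaveSourceEnergyDensity_le_extrapolate {h₁ h₂ θ lo₁ hi₂ : ℝ} (hθ : 0 ≤ θ)
    (h1 : lo₁ ≤ dWaveSourceEnergyDensity U μ h₁) (h2 : dWaveSourceEnergyDensity U μ h₂ ≤ hi₂) :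
    dWaveSourceEnergyDensity U μ (h₂ + θ * (h₂ - h₁)) ≤ hi₂ + θ * (hi₂ - lo₁) := by
  -- `h₂ = (θ/(1+θ)) h₁ + (1/(1+θ)) h₃`
  have h1θ : 0 < 1 + θ := by linarith
  set p : ℝ := θ / (1 + θ) with hpdef
  set q : ℝ := 1 / (1 + θ) with hqdef
  have hp0 : 0 ≤ p := div_nonneg hθ h1θ.le
  have hq0 : 0 ≤ q := div_nonneg zero_le_one h1θ.le
  have hpq : p + q = 1 := by rw [hpdef, hqdef, ← add_div, add_comm, div_self h1θ.ne']
  have hc := (concaveOn_dWaveSourceEnergyDensity U μ).2 (Set.mem_univ h₁) (Set.mem_univ (h₂ + θ * (h₂ - h₁)))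
    hp0 hq0 hpq
  simp only [smul_eq_mul] at hc
  have hh : p * h₁ + q * (h₂ + θ * (h₂ - h₁)) = h₂ := by
    rw [hpdef, hqdef]; field_simp; ring
  rw [hh] at hc
  -- `hc : p e(h₁) + q e(h₃) ≤ e(h₂)`; multiply by `1 + θ`
  have hc' : θ * dWaveSourceEnergyDensity U μ h₁ + dWaveSourceEnergyDensity U μ (h₂ + θ * (h₂ - h₁)) ≤
      (1 + θ) * dWaveSourceEnergyDensity U μ h₂ := by
    have := mul_le_mul_of_nonneg_left hc h1θ.le
    have e1 : (1 + θ) * (p * dWaveSourceEnergyDensity U μ h₁ +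
        q * dWaveSourceEnergyDensity U μ (h₂ + θ * (h₂ - h₁))) =
        θ * dWaveSourceEnergyDensity U μ h₁ + dWaveSourceEnergyDensity U μ (h₂ + θ * (h₂ - h₁)) := by
      rw [hpdef, hqdef]; field_simp
    linarith [this, e1]
  nlinarith [hc', mul_le_mul_of_nonneg_left h1 hθ, mul_le_mul_of_nonneg_left h2 h1θ.le]

/-- **Monotone transport of a LOWER bound** (`h ≥ 0`): a certified `lo ≤ e_src(h₂)` holds at every
`h ∈ [0, h₂]`. [cite: KomaTasaki1994, §1] -/
theorem dWaveSourceEnergyDensity_ge_of_ge_at_larger {h h₂ lo : ℝ} (hh : 0 ≤ h) (hle : h ≤ h₂)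
    (h2 : lo ≤ dWaveSourceEnergyDensity U μ h₂) : lo ≤ dWaveSourceEnergyDensity U μ h :=
  h2.trans (dWaveSourceEnergyDensity_anti U μ hh hle)

/-- **Monotone transport of an UPPER bound** (`h ≥ 0`): a certified `e_src(h₁) ≤ hi` holds at every
`h ≥ h₁ ≥ 0`; in particular every certified upper bound on the source-FREE energy density bounds every
sourced one (`dWaveSourceEnergyDensity_le_at_zero`). [cite: KomaTasaki1994, §1] -/
theorem dWaveSourceEnergyDensity_le_of_le_at_smaller {h₁ h hi : ℝ} (hh : 0 ≤ h₁) (hle : h₁ ≤ h)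
    (h1 : dWaveSourceEnergyDensity U μ h₁ ≤ hi) : dWaveSourceEnergyDensity U μ h ≤ hi :=
  (dWaveSourceEnergyDensity_anti U μ hh hle).trans h1

/-- An upper bound at `h = 0` bounds every sourced energy density. [cite: KomaTasaki1994, §1] -/
theorem dWaveSourceEnergyDensity_le_of_le_at_zero {h hi : ℝ} (h0 : dWaveSourceEnergyDensity U μ 0 ≤ hi) :
    dWaveSourceEnergyDensity U μ h ≤ hi :=
  (dWaveSourceEnergyDensity_le_at_zero U μ h).trans h0

/-- **Lipschitz transport of a LOWER bound**: `lo ≤ e_src(h)` gives `lo − 2B_d|h' − h| ≤ e_src(h')`.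
[cite: Israel1979, Thm. I.3.4] -/
theorem dWaveSourceEnergyDensity_ge_lipschitz {h h' lo : ℝ} (h1 : lo ≤ dWaveSourceEnergyDensity U μ h) :
    lo - 2 * (2 * ∑ e ∈ insert (0 : Site 2) unitSteps, |dWaveFormFactor e / Real.sqrt 2|) * |h' - h| ≤
      dWaveSourceEnergyDensity U μ h' := by
  have h2 := abs_dWaveSourceEnergyDensity_sub_le U μ h h'
  rw [abs_sub_comm h h'] at h2
  have h3 := (abs_le.1 h2).2
  linarith

/-- **Lipschitz transport of an UPPER bound**: `e_src(h) ≤ hi` gives `e_src(h') ≤ hi + 2B_d|h' − h|`.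
[cite: Israel1979, Thm. I.3.4] -/
theorem dWaveSourceEnergyDensity_le_lipschitz {h h' hi : ℝ} (h1 : dWaveSourceEnergyDensity U μ h ≤ hi) :
    dWaveSourceEnergyDensity U μ h' ≤
      hi + 2 * (2 * ∑ e ∈ insert (0 : Site 2) unitSteps, |dWaveFormFactor e / Real.sqrt 2|) * |h' - h| := by
  have h2 := abs_dWaveSourceEnergyDensity_sub_le U μ h h'
  rw [abs_sub_comm h h'] at h2
  have h3 := (abs_le.1 h2).1
  linarith

end Transport

end Literature.MathematicalPhysics.QuantumLattice

end
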